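/-
Copyright (c) 2026 the pub-hodgecm-mathlib formalisation cell (harness21).  Prover seat hodgecm-mathlib-K2E3-p31 (g3) on S4 dealer K2E2-plan (g7∕g8)'s DEAL
2026-09-05T02:09:12Z (2) ∕ 02:24:00Z (1), Track B «K2-LIT», R90-TF section S4 (h413 = `stmt-HodgeConjecture-24833`), §HC-SPLIT of `Lines/R90_S4_HPacketsU2B.lean` ED. 10:
the (U1-INV) PAYER — the invariant character density of an admissible irreducible class of the abelian factor `U(Φ₁)_v`.  THEOREMS ONLY (no `def`, no `instance`, no notation,
no named-fact hypothesis, no `sorry`); ★-only imports, NO `Lines` import (the stub's statement is COPIED, `U1Loc L v` spelled as its body).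
-/
import Literature.NumberTheory.Automorphic.CharacterLineFinConstituents              -- ★ `IrrClass.isConstituentOf_iff_eq_mk_ofChar_of_forall_apply_eq_smul` (+ ★ `finrank_eq_one_of_isIrreducible_of_smul`, ★ `SmoothIrrep.ofChar`, ★ `IrrClass.smoothTrace_mk_ofChar_of_mem`)
import Literature.NumberTheory.Automorphic.IrreducibleClassesConstituents              -- ★ `IrrClass.isConstituentOf_mk_self`
import Literature.NumberTheory.Automorphic.SmoothRepresentationCentralCharacterProofs  -- ★ Schur: `Representation.IsAdmissible.exists_apply_center_eq_smul_id`
import Literature.NumberTheory.Automorphic.LocalLanglandsGLOne                         -- ★ `Representation.existsUnique_character_of_finrank_eq_one`, `continuous_monoidHom_of_isOpen_ker`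
import Literature.NumberTheory.Automorphic.HeckeEigencharacterPackage                  -- ★ `IrrClass.IsAdmissible`, `IrrClass.isAdmissible_mk`
import Literature.NumberTheory.Automorphic.CMPrincipalSeriesJacquetEvalOne             -- ★ `UnitaryGroup.nonarchimedeanGroup_unitaryGroupOfForm_local`
import Literature.NumberTheory.Automorphic.LocalUnitaryGroupCongrMeasure               -- ★ instances `locallyCompactSpace_cmDatum_local`, `t2Space_cmDatum_local`
import Literature.NumberTheory.Rogawski1990.LocalTransferFundamentalLemma              -- ★ `IsLocSmooth`
import Literature.NumberTheory.Automorphic.AutomorphicLFunctionsProofs                 -- ★ `GL_fin_one_mul_comm` (`GL₁` of a commutative ring is commutative)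
import HarnessLib

/-!
# R90-TF · S4 «Ch. 13.1–2», §HC-SPLIT (U1-INV) — AN ADMISSIBLE IRREDUCIBLE CLASS OF THE ABELIAN FACTOR `U(Φ₁)_v` IS A SMOOTH CHARACTER `ω`, AND `Θ := ω` IS A BOREL,
# INVARIANT, LOCALLY INTEGRABLE DENSITY REPRESENTING ITS TRACE ON `C_c^∞` (Bushnell–Henniart 2006 §1.5, §2.6; Rogawski 1990 §12.1 p. 171)

Cell `hodgecm-mathlib`, crux H413 (`stmt-HodgeConjecture-24833`, lane `--supports … --as helper`), route of record `HCCMUnconditional` (no route verbs;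
count-neutral).  Programme R90-TF, section S4; S4 dealer K2E2-plan (g7) DEAL 2026-09-05T02:09:12Z (2) ∕ (g8) 02:24:00Z (1) to this seat.  CONSUMER: typist R90-C131-typ2
(g3), `Cruxes/H413/Lines/R90_S4_HPacketsU2B.lean` ED. 10, sub-sub-sub-socket `stub_R90_S4_U1_charInv` (:646–:660), paid by `exact u1_charInv` in the next delta edition —
the statement below is that stub's ∀-body VERBATIM with the line's `abbrev U1Loc L v` spelled as its body
`(UnitaryGroup.cmDatum L 1 (Matrix.of fun i j : Fin 1 => if i.val + j.val + 1 = 1 then (1 : L) else 0)).Local v` (pattern of K2E5-p17 (g9)'s `U2Loc` payers).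

THE MATHEMATICS.  `U(Φ₁)_v ≤ GL₁(L ⊗ L⁺_v)` is COMMUTATIVE (§1: ★ `GL_fin_one_mul_comm`).  For an
admissible irreducible smooth `π` of a commutative locally compact totally disconnected group every `g` is central, so acts by a scalar (Schur for admissible
irreducibles, ★ `Representation.IsAdmissible.exists_apply_center_eq_smul_id`); an irreducible representation on which the group acts by scalars is a line (★
`finrank_eq_one_of_isIrreducible_of_smul`), on which `G` acts through a character `ω` (★ `Representation.existsUnique_character_of_finrank_eq_one`) whose kernel contains
the open stabiliser of a non-zero vector (smoothness) — so `⟦π⟧ = ⟦ℂ_ω⟧` (★ `IrrClass.isConstituentOf_iff_eq_mk_ofChar_of_forall_apply_eq_smul` at the constituent `⟦π⟧`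
of `π` itself, ★ `isConstituentOf_mk_self`) — §2, stated for ANY commutative `G`.  Then `tr ⟦ℂ_ω⟧(f) = ∫ ω·f dμ` for `f ∈ C_c^∞` (★ `IrrClass.smoothTrace_mk_ofChar_of_mem`,
★ `charDist_def`), and `Θ := ω` is continuous (open kernel, ★ `continuous_monoidHom_of_isOpen_ker`) — hence Borel and locally integrable against the Haar measure — and
conjugation-invariant because `ω` takes values in the commutative `ℂˣ` (§3).
* §1 **`mul_comm_cmDatum_local_one`** (`U(Φ₁)_v` is commutative, any `Φ₁`; ★ `GL_fin_one_mul_comm`).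
* §2 **`IrrClass.exists_eq_mk_ofChar_of_isAdmissible_of_forall_commute`** — GENERIC: an admissible irreducible class of a commutative nonarchimedean locally compact group is
  `⟦ℂ_ω⟧` for a character `ω` with open kernel («irreducible + scalar action ⇒ one-dimensional», the step the stub's docstring flags as not-yet-by-name).
* §3 **`u1_charInv`** — `stub_R90_S4_U1_charInv`'s ∀-body VERBATIM.

HONEST LABEL: HC_CM is proved only modulo the 7 printed citations (2 remaining named inputs: hLiu418 = stmt-HodgeConjecture-24832, h413 =
stmt-HodgeConjecture-24833) until rung 0 closes.  (U1-INV) is one of four sub-sockets of (HC-LI) of the S4 Lines-B cone ((U2-HC) = E3 junction and (PROD) stay OPEN); this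
file pays no crux socket by itself (REL ≠ ★ ≠ BUILT).

[cite: BushnellHenniart2006, §1.1, §1.5, §2.6] [cite: Rogawski1990, §12.1 p. 171] [cite: BernsteinZelevinsky1976, Proposition 2.11]
-/

set_option autoImplicit false
-- the mandated namespace repeats the single-problem summit's segment (`HodgeConjecture.HodgeConjecture`)
set_option linter.dupNamespace false

noncomputable section

open MeasureTheory NumberField IsDedekindDomain
open scoped MatrixGroups

namespace Summit.HodgeConjecture.HodgeConjecture.R90.S4

open Literature.NumberTheory.Automorphic Literature.NumberTheory.Automorphic.UnitaryGroup
open Literature.NumberTheory.Rogawski1990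

/-! ## §1 `U(Φ₁)_v ≤ GL₁(L ⊗ L⁺_v)` is commutative -/

/-- **`U(Φ₁)(L⁺_v)` is commutative** (any `1 × 1` form `Φ₁`): it is a subgroup of the commutative `GL₁(L ⊗ L⁺_v)` (★ `GL_fin_one_mul_comm`). [cite: Rogawski1990, §12.1 p. 171] -/
theorem mul_comm_cmDatum_local_one (L : Type) [Field L] [NumberField L] [IsCMField L] (Φ₁ : Matrix (Fin 1) (Fin 1) L)
    (v : HeightOneSpectrum (𝓞 ↥(maximalRealSubfield L))) (a b : (UnitaryGroup.cmDatum L 1 Φ₁).Local v) : a * b = b * a :=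
  Subtype.ext (GL_fin_one_mul_comm (a.val : GL (Fin 1) (UnitaryGroup.LocalRing L v)) b.val)

/-! ## §2 An admissible irreducible class of a commutative nonarchimedean locally compact group is a character -/

/-- **«IRREDUCIBLE + ADMISSIBLE + COMMUTATIVE ⇒ ONE-DIMENSIONAL»**: for a commutative (`hG`) nonarchimedean locally compact topological group `G`, every
admissible irreducible class `c ∈ Irr(G)` is `⟦ℂ_ω⟧` (★ `SmoothIrrep.ofChar`) for a character `ω : G →* ℂˣ` with OPEN kernel, acting on any representative by
`π(g) v = ω(g) • v`.  Schur for admissible irreducibles (★ `Representation.IsAdmissible.exists_apply_center_eq_smul_id`; the centre is all of `G`) ⇒ scalar action ⇒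
a line (★ `finrank_eq_one_of_isIrreducible_of_smul`) ⇒ a character (★ `Representation.existsUnique_character_of_finrank_eq_one`) with kernel ⊇ the open stabiliser of a
non-zero vector ⇒ `⟦π⟧ = ⟦ℂ_ω⟧` (★ `IrrClass.isConstituentOf_iff_eq_mk_ofChar_of_forall_apply_eq_smul` + ★ `isConstituentOf_mk_self`).
[cite: BushnellHenniart2006, §1.5, §2.6] [cite: BernsteinZelevinsky1976, Proposition 2.11] -/
theorem IrrClass.exists_eq_mk_ofChar_of_isAdmissible_of_forall_commute {G : Type} [Group G] [TopologicalSpace G]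
    [NonarchimedeanGroup G] [LocallyCompactSpace G] (hG : ∀ a b : G, a * b = b * a)
    (c : IrrClass G) (hc : c.IsAdmissible) :
    ∃ (ω : G →* ℂˣ) (hω : IsOpen ((ω.ker : Subgroup G) : Set G)), c = IrrClass.mk (SmoothIrrep.ofChar ω hω) := by
  obtain ⟨π, rfl⟩ := IrrClass.mk_surjective c
  have hadm : π.ρ.IsAdmissible := (IrrClass.isAdmissible_mk π).1 hc
  haveI : π.ρ.IsIrreducible := π.isIrreducible
  -- every element is central, hence acts by a scalar (Schur for admissible irreducibles)
  have hsc : ∀ t : G, ∃ a : ℂ, ∀ w : π.V, π.ρ t w = a • w := by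
    intro t
    have ht : t ∈ Subgroup.center G := Subgroup.mem_center_iff.2 fun g => hG g t
    obtain ⟨a, ha⟩ := hadm.exists_apply_center_eq_smul_id ⟨t, ht⟩
    exact ⟨a, fun w => by simpa only [LinearMap.smul_apply, LinearMap.id_apply] using LinearMap.congr_fun ha w⟩
  -- so `π` is a line, acted on through a character `ω`
  obtain ⟨-, h1⟩ := finrank_eq_one_of_isIrreducible_of_smul π.ρ hsc
  haveI : Nontrivial π.V := Module.nontrivial_of_finrank_eq_succ h1
  obtain ⟨ω, hω, -⟩ := π.ρ.existsUnique_character_of_finrank_eq_one h1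
  -- `ker ω` contains the open stabiliser of a non-zero vector
  obtain ⟨e, he⟩ := exists_ne (0 : π.V)
  have hker : IsOpen ((ω.ker : Subgroup G) : Set G) := by
    refine Subgroup.isOpen_mono ?_ (π.isSmooth e)
    intro g hg
    rw [Representation.mem_stabilizerSubgroup] at hg
    rw [MonoidHom.mem_ker]
    ext
    refine smul_left_injective ℂ he ?_
    simp only [Units.val_one, one_smul]
    rw [← hω g e, hg]
  exact ⟨ω, hker, (IrrClass.isConstituentOf_iff_eq_mk_ofChar_of_forall_apply_eq_smul π.ρ ω hker hω (IrrClass.mk π)).1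
    (IrrClass.isConstituentOf_mk_self π)⟩

/-! ## §3 (U1-INV): the invariant character density of an admissible class of `U(Φ₁)_v` -/

/-- **(U1-INV) — CHARACTERS OF THE ABELIAN FACTOR `U(Φ₁)_v`** (`stub_R90_S4_U1_charInv` of `Lines/R90_S4_HPacketsU2B.lean` ED. 10 :646–:660, ∀-body VERBATIM with
`U1Loc L v` spelled as its body).  An admissible irreducible class `χ` of the commutative group `U(Φ₁)(L⁺_v)` (§1) is `⟦ℂ_ω⟧` for a smooth character `ω` (§2), and
`Tr χ(f) = ∫ ω·f dμ₁` for every `f ∈ C_c^∞` (★ `IrrClass.smoothTrace_mk_ofChar_of_mem`, ★ `charDist_def`; ★ `IsLocSmooth` = locally constant + compact support = membership in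
★ `SchwartzBruhat`); `Θ := ω` is continuous (open kernel, ★ `continuous_monoidHom_of_isOpen_ker`), hence Borel and locally integrable against the Haar measure `μ₁`, and
conjugation-invariant because `ω(x g x⁻¹) = ω(x) ω(g) ω(x)⁻¹ = ω(g)` in the commutative `ℂˣ`.  (`U(Φ₁)_v` non-archimedean: ★ `nonarchimedeanGroup_unitaryGroupOfForm_local`;
locally compact ∕ Hausdorff: ★ instances of `LocalUnitaryGroupCongrMeasure`.) [cite: BushnellHenniart2006, §1.1, §1.5, §2.6] [cite: Rogawski1990, §12.1 p. 171] -/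
theorem u1_charInv :
    ∀ (L : Type) [Field L] [NumberField L] [IsCMField L] (v : HeightOneSpectrum (𝓞 ↥(maximalRealSubfield L)))
      [MeasurableSpace ((UnitaryGroup.cmDatum L 1 (Matrix.of fun i j : Fin 1 => if i.val + j.val + 1 = 1 then (1 : L) else 0)).Local v)]
      [BorelSpace ((UnitaryGroup.cmDatum L 1 (Matrix.of fun i j : Fin 1 => if i.val + j.val + 1 = 1 then (1 : L) else 0)).Local v)]
      (μ₁ : MeasureTheory.Measure ((UnitaryGroup.cmDatum L 1 (Matrix.of fun i j : Fin 1 => if i.val + j.val + 1 = 1 then (1 : L) else 0)).Local v))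
      [μ₁.IsHaarMeasure]
      (χ : IrrClass ((UnitaryGroup.cmDatum L 1 (Matrix.of fun i j : Fin 1 => if i.val + j.val + 1 = 1 then (1 : L) else 0)).Local v)), χ.IsAdmissible →
      ∃ Θ : (UnitaryGroup.cmDatum L 1 (Matrix.of fun i j : Fin 1 => if i.val + j.val + 1 = 1 then (1 : L) else 0)).Local v → ℂ,
        MeasureTheory.LocallyIntegrable Θ μ₁ ∧ Measurable Θ ∧
        (∀ x g : (UnitaryGroup.cmDatum L 1 (Matrix.of fun i j : Fin 1 => if i.val + j.val + 1 = 1 then (1 : L) else 0)).Local v, Θ (x * g * x⁻¹) = Θ g) ∧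
        ∀ f : (UnitaryGroup.cmDatum L 1 (Matrix.of fun i j : Fin 1 => if i.val + j.val + 1 = 1 then (1 : L) else 0)).Local v → ℂ,
          Literature.NumberTheory.Rogawski1990.IsLocSmooth f →
            χ.smoothTrace μ₁ f = MeasureTheory.integral μ₁ (fun g => f g * Θ g) := by
  intro L _ _ _ v _ _ μ₁ _ χ hχ
  haveI : NonarchimedeanGroup ((UnitaryGroup.cmDatum L 1 (Matrix.of fun i j : Fin 1 => if i.val + j.val + 1 = 1 then (1 : L) else 0)).Local v) :=
    nonarchimedeanGroup_unitaryGroupOfForm_local (E := L) (c := IsCMField.complexConj L) (N := 1) (v := v)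
      (J' := (adelicForm L 1 (Matrix.of fun i j : Fin 1 => if i.val + j.val + 1 = 1 then (1 : L) else 0)).map (adeleToLocal L v))
  obtain ⟨ω, hω, hcls⟩ := IrrClass.exists_eq_mk_ofChar_of_isAdmissible_of_forall_commute
    (mul_comm_cmDatum_local_one L (Matrix.of fun i j : Fin 1 => if i.val + j.val + 1 = 1 then (1 : L) else 0) v) χ hχ
  have hcont : Continuous fun g : (UnitaryGroup.cmDatum L 1 (Matrix.of fun i j : Fin 1 => if i.val + j.val + 1 = 1 then (1 : L) else 0)).Local v =>
      ((ω g : ℂˣ) : ℂ) :=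
    Units.continuous_val.comp (continuous_monoidHom_of_isOpen_ker ω hω)
  refine ⟨fun g => ((ω g : ℂˣ) : ℂ), hcont.locallyIntegrable, hcont.measurable, fun x g => ?_, fun f hf => ?_⟩
  · -- invariance: `ω` takes values in the commutative `ℂˣ`
    have h : ω (x * g * x⁻¹) = ω g := by
      rw [map_mul, map_mul, map_inv, mul_right_comm, mul_inv_cancel, one_mul]
    simp only [h]
  · -- the trace of the character class `⟦ℂ_ω⟧` on a test function is `∫ ω · f`
    have hfS : f ∈ SchwartzBruhat ((UnitaryGroup.cmDatum L 1 (Matrix.of fun i j : Fin 1 => if i.val + j.val + 1 = 1 then (1 : L) else 0)).Local v) :=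
      mem_schwartzBruhat_iff.2 ⟨hf.isLocallyConstant, hf.hasCompactSupport⟩
    rw [hcls, IrrClass.smoothTrace_mk_ofChar_of_mem μ₁ hω hfS, charDist_def]
    refine integral_congr_ae (Filter.Eventually.of_forall fun g => ?_)
    exact mul_comm _ _

end Summit.HodgeConjecture.HodgeConjecture.R90.S4

end
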